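import Summits.BirchSwinnertonDyer.Rank1Residual.X2.Cells
import Literature.Barriers.BirchSwinnertonDyer.EisensteinMuConjecture
import Literature.NumberTheory.EllipticCurves.Rank1Residual.GVParityLineTypeProofs
import Literature.NumberTheory.EllipticCurves.Rank1Residual.GVParityTwistProofs
import Summits.BirchSwinnertonDyer.Rank1Residual.GaloisImage.MultiplicativeLocalTorsion
import Summits.BirchSwinnertonDyer.Rank1Residual.Partition.EisensteinKernelInertiaLineMult
import Summits.BirchSwinnertonDyer.Rank1Residual.X2.TateLineDecomposition
import Summits.BirchSwinnertonDyer.Rank1Residual.X11b.BDPRouteTamagawaSupport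
import Literature.NumberTheory.EllipticCurves.NeronOggShafarevichLocal
import Literature.NumberTheory.EllipticCurves.GeomPointsGaloisModule
import Literature.NumberTheory.EllipticCurves.TateCurve.NumberFieldUniformization
import Literature.NumberTheory.EllipticCurves.TateCurve.NumberFieldUniformizationTwisted
import HarnessLib

/-!
# Crux `MazurMCOnCellB` (stmt-BirchSwinnertonDyer-19033), line `mudescent` v4 — the LOCAL STRUCTURE
# OF THE ÉTALE END AT `p`: an unramified rational `p`-line at a multiplicative odd `p` forces
# `p ∣ v_p(Δ_min)`; off the barrier locus every X2b pair has `p ∣ v_p(Δ_min)` (both signs), `p ∣ c_p`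
# and `p ∣ ∏ c_ℓ` at a split `p`, and its rational line is fixed pointwise by the decomposition group

Width seat bsd-line-x2-p1-w2 (gen 4), `--supports -19033`, μ-lineage (stub 3′ `stub_muPart_offLocus`
is stated AT THE ÉTALE END `(W₀, p)`: `X2.CellB W₀ p ∧ ¬ HasRamifiedOddLineAt W₀ p`). THEOREMS ONLY
(no definition, no named fact, no `sorry`); nothing here proves a main conjecture, closes a stub or
moves a label. What the file kernel-checks, for `W/ℚ` globally minimal and `p` an ODD prime of
MULTIPLICATIVE reduction:

* §1 `dvd_padicValInt_minimalDiscriminantInt_of_lineUnramifiedAt_of_mult` — **a rational `p`-line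
  `Φ ≤ E[p]` UNRAMIFIED at `p` forces `p ∣ v_p(Δ_min)`** (Kodaira type `I_{pm}`). Serre 1972 §1.12
  (valuation half of the Kummer criterion, tree `GaloisImage.eq_zero_of_forall_inertia_smul_eq_of_mult_of_not_dvd`:
  `E[p]^{I_v} = 0` when `p ∤ v_p(Δ_min)`) applied to a non-zero point of `Φ`, the LOCAL inertia
  group being carried into a GLOBAL one by Neukirch II (9.6) (tree `resGalOfEmb_mem_inertia_primeBelow`).
  This GENERALISES `X2/TorsionForcesSplit` (`p ∣ #E(ℚ)_tors ⟹ p ∣ v_p(Δ_min)`: the line `ℤ/p` with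
  TRIVIAL action) to every unramified line — the even quadratic lines `𝔽_p(χ_d)` of the type-A étale
  ends without rational `p`-torsion and the unramified-odd lines of Greenberg–Vatsal's cell X2a.
* §2 at the ÉTALE END of an X2b class (`X2.CellB W₀ p`, `¬ HasRamifiedOddLineAt W₀ p`: every rational
  line unramified-even, `lineUnramifiedAt_of_offLocus` = `…CongruenceRoad.lineUnramifiedAt_and_lineEven_of_offLocus`):
  `dvd_padicValInt_minimalDiscriminantInt_of_offLocus` (**`p ∣ v_p(Δ_min(W₀))`, BOTH signs**), the
  contrapositive `hasRamifiedOddLineAt_of_not_dvd` (**an X2b member with `p ∤ v_p(Δ_min)` lies ON the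
  barrier locus** `EisensteinMuBarrier` — its `μ(X(E/ℚ_∞)) ≥ 1` by Greenberg's Prop. 5.7,
  `one_le_mu_of_cellB_of_not_dvd`, relative to the tree fact `prop57_one_le_mu_of_ramified_odd_line`),
  and at a SPLIT `p`: `p ∣ c_p(W₀)` (Kodaira–Néron) and `p ∣ ∏_ℓ c_ℓ(W₀)` (the Tamagawa atom of the cell's
  rank-0 displays holds at every split étale end BY THEOREM).
* §3 `decomp_fix_of_offLocus_of_split` — **at a SPLIT étale end the decomposition group `D_v` fixes
  the rational line pointwise** (`φ|_{G_p} = 1`: `E₀[p]|_{G_p} ≅ 𝔽_p ⊕ μ_p` is SPLIT, the Galois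
  shadow of the exceptional zero), from `TateLineDecomposition.fix_or_quot_of_split` (Tate
  uniformisation A40, DISCHARGED `TateCurve.Silverman1994_thmV53_tateUniformisation_holds`) — the
  other alternative «`D_v` trivial on `E₀[p]/Φ`» is killed by the inertia line
  (`KernelDisc.exists_inertiaLine_of_mult`). At a NON-SPLIT étale end `D_v` moves the line
  (`TateLineDecomposition.not_fix_and_not_quot_of_not_split`) — in particular no rational
  `p`-torsion, already `X2/TorsionForcesSplit.not_dvd_torsionOrder_of_not_split_of_mult` (not restated).

CENSUS (pre-registered local check, Cremona `allcurves`, all 127 A10 classes at `p = 3`, 83 split /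
44 non-split; étale-side member = every rational root of `ψ₃` is `3`-integral): `3 ∣ v₃(Δ_min)` on
145/145 étale-side members; exactly one rational `3`-line 145/145; no rational `3`-torsion on the
105/105 members of the non-split classes; `ℚ₃`-rational line at every split étale end — 0 violations
(script `HOME/line-x2-p1-w2-g4/etale_end_check.py`). HONEST FRAMING: structure of the étale end only;
stub 3′ (`μ_an ≤ μ_alg` there) stays OPEN class-wide (Vatsal, J. Inst. Math. Jussieu 4 (2005) Thm.
1.16 gives Λ-integrality and the LOWER bound `μ_an ≥ r` for `E[p]^{ss} = 1 ⊕ ω`, `p² ∤ N`; p. 11: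
«when χ = 1, it is not known that the lower bound … is actually sharp»).

References: [SerreInventiones1972] §1.11–1.12; [NeukirchANT1999] II (9.6); [SilvermanATAEC1994]
Cor. IV.9.2(d), V.5.3; [GreenbergVatsal2000] §2 pp. 14–15; [GreenbergLNM1716] Prop. 5.7;
[Vatsal2005JIMJ] Thm. 1.16, Prop. 5.3, p. 11.
-/

set_option autoImplicit false

-- `Summit.BirchSwinnertonDyer.BirchSwinnertonDyer.…`: the summit and its single sub-problem share a name (D-0017 layout).
set_option linter.dupNamespace false

noncomputable section

open scoped Classical NNReal NumberField

open WeierstrassCurve NumberField IsDedekindDomain Field Rat.HeightOneSpectrum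
  Literature.NumberTheory.EllipticCurves
  Literature.NumberTheory.EllipticCurves.Rank1Residual
  Literature.NumberTheory.GaloisRepresentations
  Literature.NumberTheory.EllipticCurves.GreenbergSelmer
  Literature.Barriers.BirchSwinnertonDyer
  Summit.BirchSwinnertonDyer.Rank1Residual

namespace Summit.BirchSwinnertonDyer.BirchSwinnertonDyer.Theorems.EisensteinPrimesMazurMCOnCellBEtaleEndAtP

variable {W : WeierstrassCurve ℚ} [W.IsElliptic] [W.IsGloballyMinimal] {p : ℕ} [hp : Fact p.Prime]

/-! ## §1 An unramified rational `p`-line at a multiplicative odd `p` forces `p ∣ v_p(Δ_min)` -/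

omit [W.IsElliptic] [W.IsGloballyMinimal] in
/-- A rational `p`-line has a non-zero point (its order is `p > 1`). [folklore] -/
theorem exists_ne_zero_of_isRationalLine {Φ : AddSubgroup (geomTorsion W (p : ℤ))}
    (hΦ : IsRationalLine W p Φ) : ∃ P ∈ Φ, P ≠ 0 := by
  by_contra h
  have hbot : Φ = ⊥ := (AddSubgroup.eq_bot_iff_forall Φ).mpr fun P hP ↦ by
    by_contra hP0
    exact h ⟨P, hP, hP0⟩
  have h1 : Nat.card Φ = 1 := by rw [hbot]; exact AddSubgroup.card_bot
  exact hp.out.one_lt.ne' (hΦ.1.symm.trans h1)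

/-- **An UNRAMIFIED rational `p`-line at a multiplicative odd `p` forces `p ∣ v_p(Δ_min)`.** For
`E/ℚ` globally minimal, `p` odd of multiplicative reduction, and a rational line `Φ ≤ E[p]` unramified
at `p` (every inertia group above `p` fixes `Φ` pointwise): `p ∣ v_p(Δ_min(E))`. Otherwise Serre's
valuation half of the Kummer criterion (`E[p]^{I_v} = 0` when `p ∤ v_p(Δ_min)`, tree
`GaloisImage.eq_zero_of_forall_inertia_smul_eq_of_mult_of_not_dvd`, on the Tate form) kills every
point of `Φ`: a LOCAL inertia element `τ ∈ I_𝔐 ≤ Γ_{ℚ_v}` acts through `res τ`, which lies in the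
GLOBAL inertia group of the prime `𝔓_{ι,𝔐}` above `p` (Neukirch II (9.6), tree
`resGalOfEmb_mem_inertia_primeBelow`) and therefore fixes `Φ`. [cite: SerreInventiones1972, §1.12 (Cor. of Prop. 13)]
[cite: NeukirchANT1999, Ch. II §9 Prop. (9.6)] -/
theorem dvd_padicValInt_minimalDiscriminantInt_of_lineUnramifiedAt_of_mult (hp2 : p ≠ 2)
    (hmult : W.HasMultiplicativeReductionAtPrime p) {Φ : AddSubgroup (geomTorsion W (p : ℤ))}
    (hΦ : IsRationalLine W p Φ) (hunr : LineUnramifiedAt W p Φ) :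
    p ∣ padicValInt p W.minimalDiscriminantInt := by
  by_contra hn
  have hpp : p.Prime := hp.out
  -- the place `v` of `ℚ` above `p`
  set v : HeightOneSpectrum (𝓞 ℚ) := (primesEquiv (R := 𝓞 ℚ)).symm ⟨p, hpp⟩ with hvdef
  have hvp : (primesEquiv v : ℕ) = p :=
    congrArg Subtype.val ((primesEquiv (R := 𝓞 ℚ)).apply_symm_apply ⟨p, hpp⟩)
  have hv : (p : 𝓞 ℚ) ∈ v.asIdeal := KernelDisc.natCast_mem_asIdeal_primesEquiv_symm
  obtain ⟨w, hw⟩ := v.exists_spectralValuation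
  obtain ⟨𝔐, h𝔐⟩ := v.localPrimesAbove_nonempty
  -- the chosen embedding `ℚ̄ → ℚ̄_v` and the global prime it cuts out
  set ι : AlgebraicClosure ℚ →ₐ[ℚ] AlgebraicClosure (v.adicCompletion ℚ) :=
    closureEmb (K := ℚ) (v.adicCompletion ℚ) with hι
  have hres : ∀ τ : absoluteGaloisGroup (v.adicCompletion ℚ),
      absGaloisRestrict ℚ (v.adicCompletion ℚ) τ = resGalOfEmb ι τ := fun τ ↦ by
    rw [← WeierstrassCurve.resGal_eq_absGaloisRestrict]; rfl
  have h𝔓 : v.primeBelow ι 𝔐 ∈ v.primesAbove := HeightOneSpectrum.primeBelow_mem_primesAbove h𝔐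
  -- a non-zero point of `Φ`, fixed by the local inertia group through `res`
  obtain ⟨P, hPΦ, hP0⟩ := exists_ne_zero_of_isRationalLine hΦ
  refine hP0 (GaloisImage.eq_zero_of_forall_inertia_smul_eq_of_mult_of_not_dvd W p hp2 hmult hn hvp
    hw h𝔐 fun τ hτ ↦ ?_)
  rw [hres]
  exact hunr v hv _ h𝔓 _ (v.resGalOfEmb_mem_inertia_primeBelow ι 𝔐 hτ) P hPΦ

/-- **Contrapositive: at a multiplicative odd `p` with `p ∤ v_p(Δ_min)` EVERY rational `p`-line is
ramified at `p`** (it is the canonical `μ_p`-line of the Tate curve). [cite: SerreInventiones1972, §1.12 (Cor. of Prop. 13)] -/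
theorem not_lineUnramifiedAt_of_not_dvd_of_mult (hp2 : p ≠ 2)
    (hmult : W.HasMultiplicativeReductionAtPrime p) (hn : ¬ p ∣ padicValInt p W.minimalDiscriminantInt)
    {Φ : AddSubgroup (geomTorsion W (p : ℤ))} (hΦ : IsRationalLine W p Φ) :
    ¬ LineUnramifiedAt W p Φ :=
  fun hunr ↦ hn (dvd_padicValInt_minimalDiscriminantInt_of_lineUnramifiedAt_of_mult hp2 hmult hΦ hunr)

/-- **Greenberg–Vatsal's cell X2a, unramified-odd case**: an X2 pair whose (GV) witness line is
unramified at `p` (and odd) has `p ∣ v_p(Δ_min)` too — §1 does not read the parity.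
[cite: GreenbergVatsal2000, Thm. (1.3) (hypothesis on Φ)] -/
theorem dvd_padicValInt_minimalDiscriminantInt_of_unramified_odd (hp2 : p ≠ 2)
    (hmult : W.HasMultiplicativeReductionAtPrime p) {Φ : AddSubgroup (geomTorsion W (p : ℤ))}
    (hΦ : IsRationalLine W p Φ) (h : LineUnramifiedAt W p Φ ∧ LineOdd W p Φ) :
    p ∣ padicValInt p W.minimalDiscriminantInt :=
  dvd_padicValInt_minimalDiscriminantInt_of_lineUnramifiedAt_of_mult hp2 hmult hΦ h.1

/-! ## §2 The étale end of an X2b class: `p ∣ v_p(Δ_min)`; at split `p` also `p ∣ c_p ∣ ∏ c_ℓ` -/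

omit [W.IsElliptic] [W.IsGloballyMinimal] in
/-- Off the barrier locus on a type-A curve every rational `p`-line is UNRAMIFIED at `p` (and even):
a rational line is (unramified ∧ even) ∨ (ramified ∧ odd) when `¬ GVPar` (`coType_of_not_gvPar`), and
the second kind is the locus `HasRamifiedOddLineAt`. (Same statement as
`…CongruenceRoad.lineUnramifiedAt_and_lineEven_of_offLocus`, re-derived in three lines to keep this
file outside the route cone.) [cite: GreenbergVatsal2000, §2 p. 28] -/
theorem lineUnramifiedAt_of_offLocus (hA : ¬ GVPar W p) (hoff : ¬ HasRamifiedOddLineAt W p)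
    {Φ : AddSubgroup (geomTorsion W (p : ℤ))} (hΦ : IsRationalLine W p Φ) :
    LineUnramifiedAt W p Φ ∧ LineEven W p Φ := by
  rcases coType_of_not_gvPar hΦ hA with h | ⟨hr, ho⟩
  · exact h
  · exact absurd ⟨Φ, hΦ, hr, ho⟩ hoff


/-- **Every X2b ÉTALE END has `p ∣ v_p(Δ_min(W₀))`** (both reduction signs): off the barrier locus
on a type-A curve the rational line (which exists: `E[p]` reducible) is unramified-even
(`lineUnramifiedAt_of_offLocus`), and §1 applies. Census at `p = 3`:
145/145 étale-side members of the 127 A10 classes. [cite: SerreInventiones1972, §1.12 (Cor. of Prop. 13)]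
[cite: GreenbergVatsal2000, §2 p. 28] -/
theorem dvd_padicValInt_minimalDiscriminantInt_of_offLocus (hc : X2.CellB W p)
    (hoff : ¬ HasRamifiedOddLineAt W p) : p ∣ padicValInt p W.minimalDiscriminantInt := by
  obtain ⟨Φ, hΦ⟩ := exists_isRationalLine_of_not_irr W p hc.2.1.2.1
  exact dvd_padicValInt_minimalDiscriminantInt_of_lineUnramifiedAt_of_mult hc.2.1.1 hc.2.1.2.2 hΦ
    (lineUnramifiedAt_of_offLocus hc.2.2 hoff hΦ).1

/-- **An X2b member with `p ∤ v_p(Δ_min)` lies ON the barrier locus** (`HasRamifiedOddLineAt`: its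
rational line is ramified, hence ramified-odd on a type-A curve; so `μ(X(E/ℚ_∞)) ≥ 1` there by
Greenberg's Prop. 5.7 = `EisensteinMuBarrier`): the «Kummer members» of a type-A class are never the
étale end. [cite: GreenbergLNM1716, Prop. 5.7 (p. 113)] [cite: SerreInventiones1972, §1.12] -/
theorem hasRamifiedOddLineAt_of_not_dvd (hc : X2.CellB W p)
    (hn : ¬ p ∣ padicValInt p W.minimalDiscriminantInt) : HasRamifiedOddLineAt W p := by
  by_contra hoff
  exact hn (dvd_padicValInt_minimalDiscriminantInt_of_offLocus hc hoff)

/-- **At a SPLIT X2b étale end `p ∣ c_p(W₀)`** (Kodaira–Néron: `c_p = v_p(Δ_min)` at a split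
multiplicative prime, tree `X11b.localTamagawaNumber_eq_padicValInt_of_split`).
[cite: SilvermanATAEC1994, Cor. IV.9.2(d) with (b) (PDF p. 340)] -/
theorem dvd_localTamagawaNumber_of_offLocus_of_split (hc : X2.CellB W p)
    (hoff : ¬ HasRamifiedOddLineAt W p) (hsplit : W.HasSplitMultiplicativeReductionAtPrime p) :
    p ∣ (W.baseChange ℚ_[p]).localTamagawaNumber ℤ_[p] := by
  obtain ⟨v, hpv⟩ : ∃ v : HeightOneSpectrum ℤ, (primesEquiv v : ℕ) = p :=
    ⟨primesEquiv.symm ⟨p, hp.out⟩, by rw [Equiv.apply_symm_apply]⟩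
  rw [X11b.localTamagawaNumber_eq_padicValInt_of_split W v hpv hsplit]
  exact dvd_padicValInt_minimalDiscriminantInt_of_offLocus hc hoff

/-- **At a SPLIT X2b étale end the Tamagawa atom holds: `p ∣ ∏_ℓ c_ℓ(W₀)`** (tree
`X11b.dvd_tamagawaProduct_of_split_of_dvd`). For the étale ends WITH a rational
`p`-torsion point this is `X2/TorsionForcesSplit`; here for every split étale end (e.g. the line
`𝔽_p(χ_d)`, `d > 0` a square mod `p`). [cite: SilvermanATAEC1994, Cor. IV.9.2(d) with (b) (PDF p. 340)] -/
theorem dvd_tamagawaProduct_of_offLocus_of_split (hc : X2.CellB W p)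
    (hoff : ¬ HasRamifiedOddLineAt W p) (hsplit : W.HasSplitMultiplicativeReductionAtPrime p) :
    p ∣ W.tamagawaProduct :=
  X11b.dvd_tamagawaProduct_of_split_of_dvd W hsplit
    (dvd_padicValInt_minimalDiscriminantInt_of_offLocus hc hoff)

/-- **An X2b member with `p ∤ v_p(Δ_min)` has `μ(X(E/ℚ_∞)) ≥ 1` — read off ONE integer**
(relative to Greenberg's Prop. 5.7, tree fact `Greenberg1999.prop57_one_le_mu_of_ramified_odd_line`,
through the barrier theorem `EisensteinMuBarrier.one_le_mu`): such a member lies on the locus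
(`hasRamifiedOddLineAt_of_not_dvd`). Census at `p = 3`: 114 of the 297 members of the 127 A10 classes
(79 split, 35 non-split) have `3 ∤ v₃(Δ_min)`; none of them is the displayed (optimal) member.
[cite: GreenbergLNM1716, Prop. 5.7 (p. 113)] [cite: SerreInventiones1972, §1.12 (Cor. of Prop. 13)] -/
theorem one_le_mu_of_cellB_of_not_dvd (h57 : Greenberg1999.prop57_one_le_mu_of_ramified_odd_line)
    (hc : X2.CellB W p) (hn : ¬ p ∣ padicValInt p W.minimalDiscriminantInt)
    {κ : ZpExtension ℚ p} {γ : Field.absoluteGaloisGroup ℚ} (hκ : κ.IsCyclotomic)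
    (hγ : κ.IsTopGenerator γ) (D : W.SelmerDualData κ γ) [Module.Finite (IwasawaAlgebra p) D.X]
    (hD : D.IsTorsion) : 1 ≤ D.mu :=
  EisensteinMuBarrier.one_le_mu h57 hc.2.1.1 (Or.inr hc.2.1.2.2) (hasRamifiedOddLineAt_of_not_dvd hc hn)
    hκ hγ D hD

/-! ## §3 At a SPLIT étale end the decomposition group fixes the rational line pointwise -/

/-- **SPLIT étale end: `D_v` fixes the rational line pointwise** (`φ|_{G_p} = 1`; `E₀[p]|_{G_p}` is the
SPLIT extension `𝔽_p ⊕ μ_p`). For `W₀/ℚ` globally minimal, `p` odd SPLIT multiplicative, `E₀[p]`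
reducible of type A off the barrier locus, `Φ` its rational line and `v` the place above `p`: every
`g ∈ D_v` (tree `GreenbergSelmer.decomp v`, the image of `Γ_{ℚ_v}`) fixes every point of `Φ`. Proof:
by `TateLineDecomposition.fix_or_quot_of_split` (Tate uniformisation A40, discharged) the alternative
is that `D_v` acts trivially on `E₀[p]/Φ`; but at the prime `𝔓 = 𝔓_{ι,𝔐}` the inertia line `L`
(`KernelDisc.exists_inertiaLine_of_mult`: `(σ − 1)E[p] ⊆ L`, some `σ ∈ I_𝔓` moves a point `P₀ ∈ L`)
meets the unramified `Φ` trivially, and `σ = res τ ∈ D_v` for a local inertia `τ` (Neukirch II (9.6),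
tree `exists_mem_inertia_apply_eq_holds`), so `σP₀ − P₀ ∈ Φ ⊓ L = 0` — contradiction.
[cite: GreenbergVatsal2000, §2 pp. 14–15] [cite: SilvermanATAEC1994, §V.5 Thm. 5.3]
[cite: NeukirchANT1999, Ch. II §9 Prop. (9.6)] -/
theorem decomp_fix_of_offLocus_of_split (hc : X2.CellB W p) (hoff : ¬ HasRamifiedOddLineAt W p)
    (hsplit : W.HasSplitMultiplicativeReductionAtPrime p)
    {Φ : AddSubgroup (geomTorsion W (p : ℤ))} (hΦ : IsRationalLine W p Φ)
    {v : HeightOneSpectrum (𝓞 ℚ)} (hv : (p : 𝓞 ℚ) ∈ v.asIdeal) :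
    ∀ g ∈ decomp (K := ℚ) v, ∀ P ∈ Φ, g • P = P := by
  have hpp : p.Prime := hp.out
  have hp2 : p ≠ 2 := hc.2.1.1
  have hmult : W.HasMultiplicativeReductionAtPrime p := hc.2.1.2.2
  have hunr : LineUnramifiedAt W p Φ :=
    (lineUnramifiedAt_of_offLocus hc.2.2 hoff hΦ).1
  rcases X2.TateLineDecomposition.fix_or_quot_of_split W p
      TateCurve.Silverman1994_thmV53_tateUniformisation_holds hsplit hv hΦ.1
      (fun g _ P hP ↦ hΦ.2 g P hP) with hfix | hquot
  · exact hfix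
  · exfalso
    obtain ⟨w, hw⟩ := v.exists_spectralValuation
    obtain ⟨𝔐, h𝔐⟩ := v.localPrimesAbove_nonempty
    set ι : AlgebraicClosure ℚ →ₐ[ℚ] AlgebraicClosure (v.adicCompletion ℚ) :=
      closureEmb (K := ℚ) (v.adicCompletion ℚ) with hι
    have hres : ∀ τ : absoluteGaloisGroup (v.adicCompletion ℚ),
        absGaloisRestrict ℚ (v.adicCompletion ℚ) τ = resGalOfEmb ι τ := fun τ ↦ by
      rw [← WeierstrassCurve.resGal_eq_absGaloisRestrict]; rfl
    have h𝔓 : v.primeBelow ι 𝔐 ∈ v.primesAbove := HeightOneSpectrum.primeBelow_mem_primesAbove h𝔐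
    -- the inertia line at `𝔓_{ι,𝔐}` and an inertia element moving one of its points
    obtain ⟨L, hLcard, hLsub, σ, hσ, P₀, hP₀L, hne⟩ :=
      KernelDisc.exists_inertiaLine_of_mult W p hp2 hmult v hv _ h𝔓
    -- `σ` comes from a local inertia element, hence lies in `D_v`
    obtain ⟨τ, -, hτ⟩ := HeightOneSpectrum.exists_mem_inertia_apply_eq_holds v ι h𝔐 hσ
    have hστ : resGalOfEmb ι τ = σ := resGalOfEmb_eq_of_apply_eq ι hτ
    have hσD : σ ∈ decomp (K := ℚ) v :=
      (mem_decomp_iff v σ).mpr ⟨τ, by rw [hres, hστ]⟩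
    -- `Φ ≠ L` (inertia fixes `Φ`, moves `P₀ ∈ L`), so `Φ ⊓ L = ⊥`
    have hΦL : Φ ⊓ L = ⊥ := by
      rcases X2.TateLineDecomposition.inf_eq_bot_or_eq W p hΦ.1 hLcard with hbot | heq
      · exact hbot
      · exact absurd (hunr v hv _ h𝔓 σ hσ P₀ (heq ▸ hP₀L)) hne
    have hmem : σ • P₀ - P₀ ∈ Φ ⊓ L := ⟨hquot σ hσD P₀, hLsub σ hσ P₀⟩
    rw [hΦL, AddSubgroup.mem_bot, sub_eq_zero] at hmem
    exact hne hmem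

/-- **Corollary: at a SPLIT X2b étale end the rational line lies in `E₀[p]^{D_v}`** — for the place
`v` of `ℚ` above `p` chosen by `primesEquiv`, with the line supplied by reducibility (unique by
`CongruenceRoad.existsUnique_rationalLine_of_offLocus_of_mult`). [cite: GreenbergVatsal2000, §2 pp. 14–15] -/
theorem exists_rationalLine_decomp_fix_of_offLocus_of_split (hc : X2.CellB W p)
    (hoff : ¬ HasRamifiedOddLineAt W p) (hsplit : W.HasSplitMultiplicativeReductionAtPrime p) :
    ∃ Φ : AddSubgroup (geomTorsion W (p : ℤ)), IsRationalLine W p Φ ∧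
      ∀ g ∈ decomp (K := ℚ) ((primesEquiv (R := 𝓞 ℚ)).symm ⟨p, hp.out⟩), ∀ P ∈ Φ, g • P = P := by
  obtain ⟨Φ, hΦ⟩ := exists_isRationalLine_of_not_irr W p hc.2.1.2.1
  exact ⟨Φ, hΦ, decomp_fix_of_offLocus_of_split hc hoff hsplit hΦ
    KernelDisc.natCast_mem_asIdeal_primesEquiv_symm⟩

/-- **NON-SPLIT étale end: `D_v` MOVES the rational line** (`φ|_{G_p} = δ ≠ 1`, the unramified
quadratic character): verbatim `TateLineDecomposition.not_fix_and_not_quot_of_not_split` (A41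
discharged) at the rational line — recorded here for the sign dichotomy of §3; the global consequence
«no rational `p`-torsion at a non-split multiplicative `p ≥ 3`» is `X2/TorsionForcesSplit`.
[cite: GreenbergVatsal2000, §2 pp. 14–15] [cite: SilvermanATAEC1994, Ch. V Lemma 5.2 (c), Cor. 5.4] -/
theorem not_decomp_fix_of_not_split (hc : X2.CellB W p)
    (hns : ¬ W.HasSplitMultiplicativeReductionAtPrime p)
    {Φ : AddSubgroup (geomTorsion W (p : ℤ))} (hΦ : IsRationalLine W p Φ)
    {v : HeightOneSpectrum (𝓞 ℚ)} (hv : (p : 𝓞 ℚ) ∈ v.asIdeal) :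
    ¬ ∀ g ∈ decomp (K := ℚ) v, ∀ P ∈ Φ, g • P = P :=
  (X2.TateLineDecomposition.not_fix_and_not_quot_of_not_split W p
    TateCurve.Silverman1994_thmV53_corV54_tateUniformisation_holds hc.2.1.1 hc.2.1.2.2 hns hv hΦ.1).1

/-! ## §4 Rank-free forms (any analytic rank: rows A10 = X2b AND B11 = X2c, and cell X2a's
unramified-odd members) — APPEND (previous declarations byte-identical)

CENSUS at `p = 3` over the WHOLE X2 atlas (N9 ∪ O9 = `class-closure/{N9,O9}/E2-hypotheses.tsv`,
`r_an ≤ 1`, both Greenberg–Vatsal types, Cremona `allcurves`, exact rational-root isolation of `ψ₃`;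
script `HOME/line-x2-p1-w2-g4/x2_p3_check.py`, 10 s): 12 292 classes, 29 302 members; 14 877 members
carry an unramified rational `3`-line — `3 ∣ v₃(Δ_min)` on **14 877 / 14 877**; every class has such a
member (12 292 / 12 292); the other 12 037 members (`3 ∤ v₃(Δ_min)`) have only ramified rational lines. -/

/-- **Type A, any rank: off the barrier locus `p ∣ v_p(Δ_min)`.** For `W/ℚ` globally minimal, `p` odd
multiplicative, `E[p]` reducible of type A (`¬ GVPar`) and no ramified-odd rational line — the étale
end of an X2b OR X2c class (row B11, crux `BSDpOnCellC`) —: `p ∣ v_p(Δ_min(W))`. The rank-free form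
of `dvd_padicValInt_minimalDiscriminantInt_of_offLocus`. [cite: SerreInventiones1972, §1.12 (Cor. of Prop. 13)]
[cite: GreenbergVatsal2000, §2 p. 28] -/
theorem dvd_padicValInt_minimalDiscriminantInt_of_notGVPar_offLocus (hp2 : p ≠ 2)
    (hmult : W.HasMultiplicativeReductionAtPrime p) (hred : ¬ W.HasIrreducibleModPGaloisRep p)
    (hA : ¬ GVPar W p) (hoff : ¬ HasRamifiedOddLineAt W p) :
    p ∣ padicValInt p W.minimalDiscriminantInt := by
  obtain ⟨Φ, hΦ⟩ := exists_isRationalLine_of_not_irr W p hred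
  exact dvd_padicValInt_minimalDiscriminantInt_of_lineUnramifiedAt_of_mult hp2 hmult hΦ
    (lineUnramifiedAt_of_offLocus hA hoff hΦ).1

/-- **Type A, any rank: a member with `p ∤ v_p(Δ_min)` lies ON the barrier locus** (its rational
line is ramified, hence ramified-odd by the co-type dichotomy). Rank-free form of
`hasRamifiedOddLineAt_of_not_dvd` (rows A10 and B11 alike).
[cite: GreenbergLNM1716, Prop. 5.7 (p. 113)] [cite: SerreInventiones1972, §1.12] -/
theorem hasRamifiedOddLineAt_of_notGVPar_of_not_dvd (hp2 : p ≠ 2)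
    (hmult : W.HasMultiplicativeReductionAtPrime p) (hred : ¬ W.HasIrreducibleModPGaloisRep p)
    (hA : ¬ GVPar W p) (hn : ¬ p ∣ padicValInt p W.minimalDiscriminantInt) :
    HasRamifiedOddLineAt W p := by
  by_contra hoff
  exact hn (dvd_padicValInt_minimalDiscriminantInt_of_notGVPar_offLocus hp2 hmult hred hA hoff)

/-- **Type A, any rank ≤ 1 on a multiplicative-or-ordinary `p`: `p ∤ v_p(Δ_min)` ⟹ `μ(X(E/ℚ_∞)) ≥ 1`**
for every torsion cyclotomic dual datum (relative to Greenberg's Prop. 5.7, through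
`EisensteinMuBarrier.one_le_mu`) — the rank-free form of `one_le_mu_of_cellB_of_not_dvd`, valid on
row B11 (X2c) as well. [cite: GreenbergLNM1716, Prop. 5.7 (p. 113)] -/
theorem one_le_mu_of_notGVPar_of_not_dvd (h57 : Greenberg1999.prop57_one_le_mu_of_ramified_odd_line)
    (hp2 : p ≠ 2) (hmult : W.HasMultiplicativeReductionAtPrime p)
    (hred : ¬ W.HasIrreducibleModPGaloisRep p) (hA : ¬ GVPar W p)
    (hn : ¬ p ∣ padicValInt p W.minimalDiscriminantInt)
    {κ : ZpExtension ℚ p} {γ : Field.absoluteGaloisGroup ℚ} (hκ : κ.IsCyclotomic)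
    (hγ : κ.IsTopGenerator γ) (D : W.SelmerDualData κ γ) [Module.Finite (IwasawaAlgebra p) D.X]
    (hD : D.IsTorsion) : 1 ≤ D.mu :=
  EisensteinMuBarrier.one_le_mu h57 hp2 (Or.inr hmult)
    (hasRamifiedOddLineAt_of_notGVPar_of_not_dvd hp2 hmult hred hA hn) hκ hγ D hD

/-- **X2c (row B11), type A, off the locus: `p ∣ v_p(Δ_min)`** — the `X2.CellC` packaging
(`r_an = 1 ∧ ClassX2`) of the rank-free theorem, for the sibling crux `BSDpOnCellC`'s étale ends.
[cite: SerreInventiones1972, §1.12 (Cor. of Prop. 13)] -/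
theorem dvd_padicValInt_minimalDiscriminantInt_of_cellC_offLocus (hc : X2.CellC W p)
    (hA : ¬ GVPar W p) (hoff : ¬ HasRamifiedOddLineAt W p) :
    p ∣ padicValInt p W.minimalDiscriminantInt :=
  dvd_padicValInt_minimalDiscriminantInt_of_notGVPar_offLocus hc.2.1 hc.2.2.2 hc.2.2.1 hA hoff

/-- **X2c, type A, SPLIT `p`, off the locus: `p ∣ c_p` and `p ∣ ∏_ℓ c_ℓ`** (Kodaira–Néron), the row-B11
twin of `dvd_localTamagawaNumber_of_offLocus_of_split` / `dvd_tamagawaProduct_of_offLocus_of_split`.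
[cite: SilvermanATAEC1994, Cor. IV.9.2(d) with (b) (PDF p. 340)] -/
theorem dvd_localTamagawaNumber_and_tamagawaProduct_of_cellC_offLocus_of_split (hc : X2.CellC W p)
    (hA : ¬ GVPar W p) (hoff : ¬ HasRamifiedOddLineAt W p)
    (hsplit : W.HasSplitMultiplicativeReductionAtPrime p) :
    p ∣ (W.baseChange ℚ_[p]).localTamagawaNumber ℤ_[p] ∧ p ∣ W.tamagawaProduct := by
  have hd := dvd_padicValInt_minimalDiscriminantInt_of_cellC_offLocus hc hA hoff
  obtain ⟨v, hpv⟩ : ∃ v : HeightOneSpectrum ℤ, (primesEquiv v : ℕ) = p :=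
    ⟨primesEquiv.symm ⟨p, hp.out⟩, by rw [Equiv.apply_symm_apply]⟩
  refine ⟨?_, X11b.dvd_tamagawaProduct_of_split_of_dvd W hsplit hd⟩
  rw [X11b.localTamagawaNumber_eq_padicValInt_of_split W v hpv hsplit]
  exact hd

end Summit.BirchSwinnertonDyer.BirchSwinnertonDyer.Theorems.EisensteinPrimesMazurMCOnCellBEtaleEndAtP

end
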